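import Literature.NumberTheory.Automorphic.UnipotentDiagConjModulus
import Literature.NumberTheory.Automorphic.MirabolicAveraging
import Literature.NumberTheory.Automorphic.WhittakerTowerCoeff
import Literature.NumberTheory.Automorphic.SiegelSetVolume
import HarnessLib

/-!
# The Iwasawa evaluation `∫_G F β = C ∫_T ∫_K F(t k) δ_B(t)⁻¹` for `N_n(𝔸)`-invariant `F` and an
# `N_n(K)`-covering weight `β`

Topic `NumberTheory/Automorphic`; namespace `Literature.NumberTheory.Automorphic`. The integration
formula behind the Iwasawa form `Ψ = ∫_{N_n(𝔸)\G} |W|² Φ |det|^s = ∫_T ∫_K … δ_B⁻¹` of the unfolded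
Rankin–Selberg integral (Cogdell (2004), §2.3; Jacquet–Shalika (1981), §4), on the objects of the
tree: the Borel subgroup `B = standardParabolicGL 𝔸_K id` with its Levi–unipotent splitting
`B = T ⋉ N` (`leviP`, `unipotentRadicalP`, `leviUnipotentHomeomorph`,
**`isTopSemidirect_standardParabolicGL`** of `ParabolicSemidirect`, consumed exactly as in
`SiegelSetVolume`), the Iwasawa decomposition `G = B K` with `K = standardMaximalCompactGL n K`
(`exists_borel_mul_standardMaximalCompactGL`, `HaarHK.eq_smul_map_prod`), and the modulus
`δ = colRangeDiagModulus 1 (n-1) d` of `u ↦ diag(d) u diag(d)⁻¹` on `N_n(𝔸_K) = U_{[1,n-1]}(𝔸_K)`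
(`UnipotentDiagConjModulus`). New here:

* `borelDiagUnit b` — the diagonal entries of `b ∈ B(𝔸_K)` as ideles, `eq_glDiagonal_of_mem_leviP_id`
  (`t = diag(borelDiagUnit t)` on the torus `T = leviP 𝔸_K id`) and the convenience isomorphism
  `borelTorusEquiv : (𝔸_Kˣ)ⁿ ≃ₜ* T`;
* `uniEquivColRange : N ≃ₜ* U_{[1,n-1]}(𝔸_K)` (`unipotentRadicalPEquiv` of `SiegelSetVolumeCoordinates`
  followed by `colRangeEquivUnipotent⁻¹` of `WhittakerTowerCoeff`) and `uniEquivColRange_conj`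
  (conjugation by `t ∈ T` is `colRangeDiagConj 1 (n-1) (borelDiagUnit t)`);
* `lintegral_weight_colRange_one_eq` — `∫_{N_n(𝔸_K)} β(u x) du = μ(box)` for an `N_n(K)`-covering
  weight `β` (`tsum_lintegral_eq_measure_box` of `MirabolicAveraging` at depth `0`, corner `1`);
* `exists_lintegral_mul_weight_eq_mul_lintegral_torus_maximalCompact` — **the Iwasawa evaluation**:
  for Haar measures `ν` on `G`, `μ_T` on `T`, `μ_K` on `K` there is `C ∈ (0,∞)` with
  `∫_G F β dν = C ∫_T ∫_K F(t k) δ(borelDiagUnit t)⁻¹ dμ_K dμ_T` for every measurable `F ≥ 0` left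
  `N_n(𝔸_K)`-invariant and every measurable `N_n(K)`-covering weight `β`
  (`dg = c · d_ℓb dk`, `d_ℓ(t u) = dt du`, `F(t u k) = F(t k)`,
  `∫_N β(t u k) du = δ(t)⁻¹ ∫_N β(u t k) du = δ(t)⁻¹ μ(box)`).

Everything is proved.

## References

* J. W. Cogdell, *Analytic theory of L-functions for GL_n* (2004), §2.3 [CogdellAnalyticTheory2004].
* J. R. Getz, H. Hahn, *An Introduction to Automorphic Representations* (2024), Prop. 3.2.1
  [GetzHahn2024].
-/

noncomputable section

open MeasureTheory Measure NumberField IsDedekindDomain Matrix Set Filter Topology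
open scoped MatrixGroups ENNReal NNReal

namespace Literature.NumberTheory.Automorphic

section Borel

variable {n : ℕ} {K : Type} [Field K] [NumberField K]

local notation "𝔸" => AdeleRing (𝓞 K) K
local notation "Bor" => standardParabolicGL (AdeleRing (𝓞 K) K) (id : Fin n → Fin n)
local notation "Tor" => leviP (AdeleRing (𝓞 K) K) (id : Fin n → Fin n)
local notation "Uni" => unipotentRadicalP (AdeleRing (𝓞 K) K) (id : Fin n → Fin n)

/-! ### The diagonal entries of `b ∈ B(𝔸_K)` as ideles -/

/-- Entries below the diagonal of `b ∈ B` vanish. [folklore] -/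
theorem borel_apply_of_lt (b : ↥(Bor)) {i j : Fin n} (hji : j < i) :
    ((b : GL (Fin n) 𝔸) : Matrix (Fin n) (Fin n) 𝔸) i j = 0 :=
  (mem_standardParabolicGL_iff _ _).1 b.2 hji

/-- `b_{ii} (b⁻¹)_{ii} = 1` for `b ∈ B` (both triangular). [folklore] -/
theorem borel_diag_mul_inv_diag (b : ↥(Bor)) (i : Fin n) :
    ((b : GL (Fin n) 𝔸) : Matrix (Fin n) (Fin n) 𝔸) i i *
      (((b⁻¹ : ↥(Bor)) : GL (Fin n) 𝔸) : Matrix (Fin n) (Fin n) 𝔸) i i = 1 := by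
  have h : (((b : GL (Fin n) 𝔸) : Matrix (Fin n) (Fin n) 𝔸) *
      (((b⁻¹ : ↥(Bor)) : GL (Fin n) 𝔸) : Matrix (Fin n) (Fin n) 𝔸)) i i = 1 := by
    rw [Subgroup.coe_inv, ← Units.val_mul, mul_inv_cancel, Units.val_one, Matrix.one_apply_eq]
  rw [Matrix.mul_apply, Finset.sum_eq_single i] at h
  · exact h
  · intro k _ hki
    rcases lt_or_gt_of_ne hki with hlt | hgt
    · rw [borel_apply_of_lt b hlt, zero_mul]
    · rw [borel_apply_of_lt b⁻¹ hgt, mul_zero]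
  · intro hi; exact (hi (Finset.mem_univ i)).elim

/-- The same on the other side. [folklore] -/
theorem borel_inv_diag_mul_diag (b : ↥(Bor)) (i : Fin n) :
    (((b⁻¹ : ↥(Bor)) : GL (Fin n) 𝔸) : Matrix (Fin n) (Fin n) 𝔸) i i *
      ((b : GL (Fin n) 𝔸) : Matrix (Fin n) (Fin n) 𝔸) i i = 1 := by
  rw [mul_comm]; exact borel_diag_mul_inv_diag b i

/-- **The diagonal entries of `b ∈ B(𝔸_K)` are ideles** (with inverses the diagonal entries of `b⁻¹`).
[folklore] -/
def borelDiagUnit (b : ↥(Bor)) (i : Fin n) : 𝔸ˣ where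
  val := ((b : GL (Fin n) 𝔸) : Matrix (Fin n) (Fin n) 𝔸) i i
  inv := (((b⁻¹ : ↥(Bor)) : GL (Fin n) 𝔸) : Matrix (Fin n) (Fin n) 𝔸) i i
  val_inv := borel_diag_mul_inv_diag b i
  inv_val := borel_inv_diag_mul_diag b i

/-- The value of `borelDiagUnit b i` is `b_{ii}` (definitional). [folklore] -/
@[simp]
theorem coe_borelDiagUnit (b : ↥(Bor)) (i : Fin n) :
    (borelDiagUnit b i : 𝔸) = ((b : GL (Fin n) 𝔸) : Matrix (Fin n) (Fin n) 𝔸) i i := rfl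

/-- `borelDiagUnit` is continuous (entries of `b` and of `b⁻¹` are continuous). [folklore] -/
theorem continuous_borelDiagUnit : Continuous (borelDiagUnit (n := n) (K := K)) := by
  refine continuous_pi fun i => Units.continuous_iff.2 ⟨?_, ?_⟩
  · exact (Units.continuous_val.comp continuous_subtype_val).matrix_elem i i
  · change Continuous fun b : ↥(Bor) => (((b⁻¹ : ↥(Bor)) : GL (Fin n) 𝔸) : Matrix (Fin n) (Fin n) 𝔸) i i
    exact (Units.continuous_val.comp (continuous_subtype_val.comp continuous_inv)).matrix_elem i i

/-- The diagonal matrix `diag(d)` as an element of `B`. [folklore] -/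
def borelOfDiag (d : Fin n → 𝔸ˣ) : ↥(Bor) := ⟨glDiagonal n 𝔸 d, glDiagonal_mem_standardParabolicGL d⟩

/-- The underlying matrix of `borelOfDiag d` (definitional). [folklore] -/
@[simp]
theorem coe_borelOfDiag (d : Fin n → 𝔸ˣ) : ((borelOfDiag d : ↥(Bor)) : GL (Fin n) 𝔸) = glDiagonal n 𝔸 d := rfl

/-- The diagonal entries of `diag(d)` are `d`. [folklore] -/
theorem borelDiagUnit_borelOfDiag (d : Fin n → 𝔸ˣ) : borelDiagUnit (borelOfDiag d) = d := by
  funext i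
  refine Units.ext ?_
  rw [coe_borelDiagUnit, coe_borelOfDiag, coe_glDiagonal, Matrix.diagonal_apply_eq]

/-- **An element of the torus `T = leviP 𝔸_K id` is the diagonal matrix of its diagonal entries**
(`apply_eq_zero_of_mem_leviP_id`). [folklore] -/
theorem eq_glDiagonal_of_mem_leviP_id {t : ↥(Bor)} (ht : t ∈ (Tor)) :
    (t : GL (Fin n) 𝔸) = glDiagonal n 𝔸 (borelDiagUnit t) := by
  refine Units.ext (Matrix.ext fun i j => ?_)
  rw [coe_glDiagonal]
  by_cases hij : i = j
  · subst hij; rw [Matrix.diagonal_apply_eq]; rfl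
  · rw [Matrix.diagonal_apply_ne _ hij, apply_eq_zero_of_mem_leviP_id ht hij]

/-- The same inside `B`. [folklore] -/
theorem eq_borelOfDiag_of_mem_leviP_id {t : ↥(Bor)} (ht : t ∈ (Tor)) : t = borelOfDiag (borelDiagUnit t) :=
  Subtype.ext (eq_glDiagonal_of_mem_leviP_id ht)

/-- **`(𝔸_Kˣ)ⁿ ≃ₜ* T`**, `d ↦ diag(d)` (`glDiagonal_mem_leviP_id`), with inverse `borelDiagUnit`.
[folklore] -/
def borelTorusEquiv : (Fin n → 𝔸ˣ) ≃ₜ* ↥(Tor) where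
  toFun d := ⟨borelOfDiag d, glDiagonal_mem_leviP_id d⟩
  invFun t := borelDiagUnit (t : ↥(Bor))
  left_inv d := borelDiagUnit_borelOfDiag d
  right_inv t := Subtype.ext (eq_borelOfDiag_of_mem_leviP_id t.2).symm
  map_mul' d e := Subtype.ext (Subtype.ext (map_mul (glDiagonal n 𝔸) d e))
  continuous_toFun := by
    refine Continuous.subtype_mk (Continuous.subtype_mk ?_ _) _
    refine Units.continuous_iff.2 ⟨?_, ?_⟩
    · change Continuous fun d : Fin n → 𝔸ˣ => ((glDiagonal n 𝔸 d : GL (Fin n) 𝔸) : Matrix (Fin n) (Fin n) 𝔸)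
      simp only [coe_glDiagonal]
      exact Continuous.matrix_diagonal (continuous_pi fun k => Units.continuous_val.comp (continuous_apply k))
    · change Continuous fun d : Fin n → 𝔸ˣ => (((glDiagonal n 𝔸 d)⁻¹ : GL (Fin n) 𝔸) : Matrix (Fin n) (Fin n) 𝔸)
      have e : (fun d : Fin n → 𝔸ˣ => (((glDiagonal n 𝔸 d)⁻¹ : GL (Fin n) 𝔸) : Matrix (Fin n) (Fin n) 𝔸)) =
          fun d => Matrix.diagonal fun k => (((d k)⁻¹ : 𝔸ˣ) : 𝔸) := by
        funext d; rw [← map_inv, coe_glDiagonal]; rfl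
      rw [e]
      exact Continuous.matrix_diagonal (continuous_pi fun k => Units.continuous_coe_inv.comp (continuous_apply k))
  continuous_invFun := continuous_borelDiagUnit.comp continuous_subtype_val

/-- The underlying matrix of `borelTorusEquiv d` is `diag(d)` (definitional). [folklore] -/
@[simp]
theorem coe_borelTorusEquiv (d : Fin n → 𝔸ˣ) :
    (((borelTorusEquiv (n := n) (K := K) d : ↥(Tor)) : ↥(Bor)) : GL (Fin n) 𝔸) = glDiagonal n 𝔸 d := rfl

/-- `borelDiagUnit (borelTorusEquiv d) = d`. [folklore] -/
theorem borelDiagUnit_borelTorusEquiv (d : Fin n → 𝔸ˣ) :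
    borelDiagUnit ((borelTorusEquiv (n := n) (K := K) d : ↥(Tor)) : ↥(Bor)) = d :=
  borelDiagUnit_borelOfDiag d

/-! ### The unipotent radical as the column range `U_{[1,n-1]}` -/

/-- **`N ≃ₜ* U_{[1,n-1]}(𝔸_K)`**: `unipotentRadicalPEquiv` followed by `colRangeEquivUnipotent⁻¹` (the
identity on matrices). [folklore] -/
def uniEquivColRange : ↥(Uni) ≃ₜ* ↥(adelicColRange n K 1 (n - 1)) :=
  (unipotentRadicalPEquiv n K).trans (colRangeEquivUnipotent (n := n) (K := K)).symm

/-- The underlying matrix of `uniEquivColRange u` is that of `u`. [folklore] -/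
@[simp]
theorem coe_uniEquivColRange (u : ↥(Uni)) :
    ((uniEquivColRange (n := n) (K := K) u : ↥(adelicColRange n K 1 (n - 1))) : GL (Fin n) 𝔸) = ((u : ↥(Bor)) : GL (Fin n) 𝔸) :=
  rfl

/-- The underlying matrix of `uniEquivColRange.symm v` is that of `v`. [folklore] -/
@[simp]
theorem coe_uniEquivColRange_symm (v : ↥(adelicColRange n K 1 (n - 1))) :
    ((((uniEquivColRange (n := n) (K := K)).symm v : ↥(Uni)) : ↥(Bor)) : GL (Fin n) 𝔸) = v := rfl

/-- **Conjugation by the torus is `colRangeDiagConj`**: for `t ∈ T` and `u ∈ N`, the element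
`t u t⁻¹ ∈ N` corresponds under `uniEquivColRange` to `colRangeDiagConj 1 (n-1) (borelDiagUnit t) u`.
[folklore] -/
theorem uniEquivColRange_conj (t : ↥(Tor)) (u : ↥(Uni)) :
    (uniEquivColRange (n := n) (K := K) ⟨(t : ↥(Bor)) * (u : ↥(Bor)) * (t : ↥(Bor))⁻¹,
        (inferInstance : (Uni).Normal).conj_mem _ u.2 _⟩ : ↥(adelicColRange n K 1 (n - 1))) =
      colRangeDiagConj (n := n) (K := K) 1 (n - 1) (borelDiagUnit (t : ↥(Bor))) (uniEquivColRange u) := by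
  refine Subtype.ext ?_
  rw [coe_colRangeDiagConj, coe_uniEquivColRange, coe_uniEquivColRange, ← eq_glDiagonal_of_mem_leviP_id t.2]
  rfl

end Borel

/-! ### The Iwasawa evaluation -/

section Iwasawa

variable {n : ℕ} {K : Type} [Field K] [NumberField K]
variable [MeasurableSpace (GL (Fin n) (AdeleRing (𝓞 K) K))] [BorelSpace (GL (Fin n) (AdeleRing (𝓞 K) K))]

local notation "𝔸" => AdeleRing (𝓞 K) K
local notation "Bor" => standardParabolicGL (AdeleRing (𝓞 K) K) (id : Fin n → Fin n)
local notation "Tor" => leviP (AdeleRing (𝓞 K) K) (id : Fin n → Fin n)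
local notation "Uni" => unipotentRadicalP (AdeleRing (𝓞 K) K) (id : Fin n → Fin n)
local notation "Kc" => standardMaximalCompactGL n K

/-- **The unipotent fibre integral of an `N_n(K)`-covering weight is the box volume** (for `0 < n`):
`∫_{U_{[1,n-1]}(𝔸_K)} β(u x) du = μ(box)` (`tsum_lintegral_eq_measure_box` at depth `0`, corner `1`,
where the corner group `(Q_0 ⊓ GL_1)(K)` is trivial). [folklore] -/
theorem lintegral_weight_colRange_one_eq {β : GL (Fin n) 𝔸 → ℝ≥0∞} (hn : 0 < n)
    (hβm : Measurable β) (hβ : ∀ x, Literature.MeasureTheory.Group.coveringSum ↥(ratPoints (tailUnipotent n K 0)) β x = 1)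
    (x : GL (Fin n) 𝔸) :
    ∫⁻ u : ↥(adelicColRange n K 1 (n - 1)), β ((u : GL (Fin n) 𝔸) * x)
        ∂(Measure.haar (G := ↥(adelicColRange n K 1 (n - 1)))) =
      (Measure.haar (G := ↥(adelicColRange n K 1 (n - 1)))) (colRangeTateDomain n K 1 (n - 1)) := by
  have h := tsum_lintegral_eq_measure_box (n := n) (K := K) (d := 0) (c := 1) (Nat.zero_le 1) hn hn hβm hβ x
  -- the corner group `(Q_0 ⊓ GL_1)(K)` is trivial: the sum has the single term `k = 1`
  have hone : ∀ k : ↥(ratPoints (tailUnipotent n K 0 ⊓ cornerGL n K 1)), (k : GL (Fin n) 𝔸) = 1 := by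
    intro k
    obtain ⟨k₀, hk₀, hk₀e⟩ := (mem_ratPoints_iff _ _).1 k.2
    have hk1 : k₀ = 1 := by
      refine Units.ext (Matrix.ext fun i j => ?_)
      rcases le_or_gt j i with hji | hij
      · rw [mem_tailUnipotent_iff.1 (Subgroup.mem_inf.1 hk₀).1 i j (Nat.zero_le _) hji, Units.val_one, Matrix.one_apply]
      · rw [(Subgroup.mem_inf.1 hk₀).2 i j (Or.inr (by have := Fin.lt_def.1 hij; omega)), Units.val_one,
          Matrix.one_apply]
    rw [← hk₀e, hk1, map_one]
  haveI : Subsingleton ↥(ratPoints (tailUnipotent n K 0 ⊓ cornerGL n K 1)) :=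
    ⟨fun k k' => Subtype.ext ((hone k).trans (hone k').symm)⟩
  rw [tsum_eq_single (1 : ↥(ratPoints (tailUnipotent n K 0 ⊓ cornerGL n K 1))) (fun k hk => absurd (Subsingleton.elim k 1) hk)] at h
  simpa only [Subgroup.coe_one, one_mul] using h

/-- **The Iwasawa evaluation `∫_G F β = C ∫_T ∫_K F(t k) δ(t)⁻¹ dk dt`.** Let `0 < n`, `ν` a Haar measure
on `GL_n(𝔸_K)`, `μ_T` a Haar measure on the diagonal torus `T = leviP 𝔸_K id ≤ B(𝔸_K)` and `μ_K` a Haar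
measure on `K = standardMaximalCompactGL n K`. There is `C ∈ (0, ∞)` such that for every measurable
`F ≥ 0` left-invariant under `N_n(𝔸_K) = U_{[1,n-1]}(𝔸_K)` and every measurable `N_n(K)`-covering
weight `β`,

  `∫ F β dν = C ∫_T ∫_K F(t k) δ(t)⁻¹ dμ_K dμ_T`,

`δ(t) = colRangeDiagModulus 1 (n-1) (borelDiagUnit t)` the modulus of `u ↦ t u t⁻¹` on `N_n(𝔸_K)`
(`= δ_B(t)`): `GL_n(𝔸_K) = B K` with `dg = c · d_ℓb dk` (`HaarHK.eq_smul_map_prod`,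
`exists_borel_mul_standardMaximalCompactGL`), `d_ℓ(t u) = dt du` (`isTopSemidirect_standardParabolicGL`),
`F(t u k) = F(t k)` and `∫_N β(t u k) du = δ(t)⁻¹ ∫_N β(u t k) du = δ(t)⁻¹ μ(box)`
(`map_colRangeDiagConj_eq_smul`, `lintegral_weight_colRange_one_eq`). This is the integration formula
behind the Iwasawa evaluation of the Rankin–Selberg integral (Cogdell (2004), §2.3; Jacquet–Shalika
(1981), §4). [folklore] -/
theorem exists_lintegral_mul_weight_eq_mul_lintegral_torus_maximalCompact (hn : 0 < n)
    (ν : Measure (GL (Fin n) 𝔸)) [IsHaarMeasure ν]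
    (μT : Measure ↥(Tor)) [IsHaarMeasure μT]
    (μK : Measure ↥(Kc)) [IsHaarMeasure μK] :
    ∃ C : ℝ≥0∞, C ≠ 0 ∧ C ≠ ⊤ ∧
      ∀ {F : GL (Fin n) 𝔸 → ℝ≥0∞}, Measurable F →
        (∀ u : GL (Fin n) 𝔸, u ∈ adelicColRange n K 1 (n - 1) → ∀ x, F (u * x) = F x) →
      ∀ {β : GL (Fin n) 𝔸 → ℝ≥0∞}, Measurable β →
        (∀ x, Literature.MeasureTheory.Group.coveringSum ↥(ratPoints (tailUnipotent n K 0)) β x = 1) →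
        ∫⁻ x, F x * β x ∂ν =
          C * ∫⁻ t, ∫⁻ k, F (((t : ↥(Bor)) : GL (Fin n) 𝔸) * (k : GL (Fin n) 𝔸)) *
            ((colRangeDiagModulus (n := n) (K := K) 1 (n - 1) (borelDiagUnit (t : ↥(Bor))) : ℝ≥0∞))⁻¹ ∂μK ∂μT := by
  -- instances on `G`, `B ⊇ T, N`, `K` (as in `SiegelSetVolume.exists_measure_conj_mul_mul_le`)
  haveI : T2Space (GL (Fin n) 𝔸) := t2Space_gl n K
  haveI : SecondCountableTopology (GL (Fin n) 𝔸) := secondCountableTopology_generalLinearGroup_adeleRing K (Fin n)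
  haveI : LocallyCompactSpace (GL (Fin n) 𝔸) := AdelicGroupData.locallyCompactSpace_generalLinearGroup_adeleRing K (Fin n)
  have hH : IsClosed ((Bor : Subgroup (GL (Fin n) 𝔸)) : Set (GL (Fin n) 𝔸)) := by
    haveI := t2Space_adeleRing K
    exact standardParabolicGL_isClosed (id : Fin n → Fin n)
  have hK : IsCompact ((Kc : Subgroup (GL (Fin n) 𝔸)) : Set (GL (Fin n) 𝔸)) := isCompact_standardMaximalCompactGL n K
  have hHK : ∀ g : GL (Fin n) 𝔸, ∃ h ∈ (Bor), ∃ k ∈ (Kc), g = h * k := exists_borel_mul_standardMaximalCompactGL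
  haveI : LocallyCompactSpace ↥(Bor) := hH.locallyCompactSpace
  haveI : CompactSpace ↥(Kc) := isCompact_iff_compactSpace.1 hK
  haveI : SecondCountableTopology ↥(Kc) := TopologicalSpace.Subtype.secondCountableTopology _
  haveI : SecondCountableTopology ↥(Bor) := TopologicalSpace.Subtype.secondCountableTopology _
  haveI : SecondCountableTopology ↥(Tor) := TopologicalSpace.Subtype.secondCountableTopology _
  haveI : SecondCountableTopology ↥(Uni) := TopologicalSpace.Subtype.secondCountableTopology _
  haveI : SecondCountableTopology ↥(adelicColRange n K 1 (n - 1)) := TopologicalSpace.Subtype.secondCountableTopology _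
  haveI : LocallyCompactSpace ↥(adelicColRange n K 1 (n - 1)) :=
    (isClosed_adelicColRange (n := n) (K := K) (a := 1) (b := n - 1)).locallyCompactSpace
  haveI : μK.IsInvInvariant := isInvInvariant_of_compactSpace μK
  -- the semidirect structure of the tree and the Haar measure `dt du` on `B`
  set e : ↥(Tor) × ↥(Uni) ≃ₜ ↥(Bor) := leviUnipotentHomeomorph (AdeleRing (𝓞 K) K) (id : Fin n → Fin n) with he
  have hsd : IsTopSemidirect (Tor) (Uni) e := by
    haveI := t2Space_adeleRing K
    exact isTopSemidirect_standardParabolicGL (AdeleRing (𝓞 K) K) (id : Fin n → Fin n)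
  haveI : LocallyCompactSpace ↥(Tor) := hsd.isClosed_left.locallyCompactSpace
  haveI : LocallyCompactSpace ↥(Uni) := hsd.isClosed_right.locallyCompactSpace
  set E := uniEquivColRange (n := n) (K := K) with hE
  set μN : Measure ↥(adelicColRange n K 1 (n - 1)) := Measure.haar with hμN
  set μU : Measure ↥(Uni) := μN.map E.symm with hμU
  haveI : IsHaarMeasure μU := E.symm.isHaarMeasure_map μN
  haveI := hsd.isHaarMeasure_map μT μU
  set μB : Measure ↥(Bor) := (μT.prod μU).map e with hμB
  -- the decomposition `ν = c · a_*(μB ⊗ μK)`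
  have hν := HaarHK.eq_smul_map_prod hH hK hHK ν μB μK
  set c : ℝ≥0 := HaarHK.decompConst hH hK hHK ν μB μK with hc
  have hc0 : (c : ℝ≥0∞) ≠ 0 := by exact_mod_cast (HaarHK.decompConst_pos hH hK hHK ν μB μK).ne'
  set V := μN (colRangeTateDomain n K 1 (n - 1)) with hV
  have hV0 : V ≠ 0 := (measure_colRangeTateDomain_pos_of_isHaarMeasure μN).ne'
  have hVtop : V ≠ ⊤ := (measure_colRangeTateDomain_lt_top μN).ne
  refine ⟨c * V, mul_ne_zero hc0 hV0, ENNReal.mul_ne_top ENNReal.coe_ne_top hVtop, ?_⟩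
  intro F hF hFN β hβm hβ
  set Φ : GL (Fin n) 𝔸 → ℝ≥0∞ := fun x => F x * β x with hΦ
  have hΦm : Measurable Φ := hF.mul hβm
  -- Step 1: `∫_G Φ = c ∫_B ∫_K Φ(b k)`
  have step1 : ∫⁻ x, Φ x ∂ν = c * ∫⁻ b, ∫⁻ k, Φ ((b : GL (Fin n) 𝔸) * (k : GL (Fin n) 𝔸)) ∂μK ∂μB := by
    have hkm : Measurable (HaarHK.hkMap (Bor) (Kc)) := HaarHK.continuous_hkMap.measurable
    conv_lhs => rw [hν]
    rw [lintegral_smul_measure, lintegral_map hΦm hkm, smul_eq_mul]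
    congr 1
    rw [lintegral_prod _ (show Measurable fun p => Φ (HaarHK.hkMap (Bor) (Kc) p) from hΦm.comp hkm).aemeasurable]
    refine lintegral_congr fun b => ?_
    have h := ((measurePreserving_inv μK).lintegral_comp_emb (MeasurableEquiv.inv _).measurableEmbedding
      (fun k : ↥(Kc) => Φ ((b : GL (Fin n) 𝔸) * (k : GL (Fin n) 𝔸))))
    rw [← h]
    refine lintegral_congr fun k => ?_
    simp only [HaarHK.hkMap_apply, Subgroup.coe_inv]
  -- Step 2: `∫_B G dμB = ∫_T ∫_N G(t u)`, with `N` in the coordinates `U_{[1,n-1]}`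
  have step2 : ∀ (G : ↥(Bor) → ℝ≥0∞), Measurable G →
      ∫⁻ b, G b ∂μB = ∫⁻ t, ∫⁻ v, G ((t : ↥(Bor)) * ((E.symm v : ↥(Uni)) : ↥(Bor))) ∂μN ∂μT := by
    intro G hG
    have hem : Measurable e := e.continuous.measurable
    rw [hμB, lintegral_map hG hem, lintegral_prod _ (show Measurable fun p => G (e p) from hG.comp hem).aemeasurable]
    refine lintegral_congr fun t => ?_
    have hf : Measurable fun y : ↥(Uni) => G (e (t, y)) := hG.comp (hem.comp (measurable_const.prodMk measurable_id))
    have hEm : Measurable fun v : ↥(adelicColRange n K 1 (n - 1)) => E.symm v := E.symm.continuous.measurable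
    rw [hμU, lintegral_map hf hEm]
    rfl
  -- Step 3: the unipotent integral for fixed `t` and `y`
  have step3 : ∀ (t : ↥(Tor)) (y : GL (Fin n) 𝔸),
      ∫⁻ v : ↥(adelicColRange n K 1 (n - 1)), Φ ((((t : ↥(Bor)) : GL (Fin n) 𝔸)) * (v : GL (Fin n) 𝔸) * y) ∂μN =
        F ((((t : ↥(Bor)) : GL (Fin n) 𝔸)) * y) *
          (((colRangeDiagModulus (n := n) (K := K) 1 (n - 1) (borelDiagUnit (t : ↥(Bor))) : ℝ≥0∞))⁻¹ * V) := by
    intro t y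
    set d := borelDiagUnit (t : ↥(Bor)) with hd
    have htd : ((t : ↥(Bor)) : GL (Fin n) 𝔸) = glDiagonal n 𝔸 d := eq_glDiagonal_of_mem_leviP_id t.2
    set θ := colRangeDiagConj (n := n) (K := K) 1 (n - 1) d with hθ
    have hpt : ∀ v : ↥(adelicColRange n K 1 (n - 1)),
        Φ (glDiagonal n 𝔸 d * (v : GL (Fin n) 𝔸) * y) =
          F (glDiagonal n 𝔸 d * y) * β (((θ v : ↥(adelicColRange n K 1 (n - 1))) : GL (Fin n) 𝔸) * (glDiagonal n 𝔸 d * y)) := by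
      intro v
      have hconj : glDiagonal n 𝔸 d * (v : GL (Fin n) 𝔸) * y =
          ((θ v : ↥(adelicColRange n K 1 (n - 1))) : GL (Fin n) 𝔸) * (glDiagonal n 𝔸 d * y) := by
        rw [hθ, coe_colRangeDiagConj]; group
      rw [hΦ]
      simp only
      rw [hconj, hFN _ (θ v).2]
    rw [htd]
    simp_rw [hpt]
    rw [lintegral_const_mul _ (show Measurable fun v : ↥(adelicColRange n K 1 (n - 1)) =>
        β (((θ v : ↥(adelicColRange n K 1 (n - 1))) : GL (Fin n) 𝔸) * (glDiagonal n 𝔸 d * y)) from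
      hβm.comp ((continuous_subtype_val.comp θ.continuous).mul continuous_const).measurable)]
    congr 1
    have hmeas : Measurable fun m : ↥(adelicColRange n K 1 (n - 1)) => β ((m : GL (Fin n) 𝔸) * (glDiagonal n 𝔸 d * y)) :=
      hβm.comp (continuous_subtype_val.mul continuous_const).measurable
    have hθm : Measurable fun v : ↥(adelicColRange n K 1 (n - 1)) => θ v := θ.continuous.measurable
    have h1 : ∫⁻ v, β (((θ v : ↥(adelicColRange n K 1 (n - 1))) : GL (Fin n) 𝔸) * (glDiagonal n 𝔸 d * y)) ∂μN =
        ∫⁻ m, β ((m : GL (Fin n) 𝔸) * (glDiagonal n 𝔸 d * y)) ∂(μN.map fun v => θ v) := by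
      rw [lintegral_map hmeas hθm]
    rw [h1, map_colRangeDiagConj_eq_smul, lintegral_smul_measure, lintegral_weight_colRange_one_eq hn hβm hβ,
      smul_eq_mul]
  -- assemble
  rw [step1]
  have hGm : Measurable fun b : ↥(Bor) => ∫⁻ k, Φ ((b : GL (Fin n) 𝔸) * (k : GL (Fin n) 𝔸)) ∂μK := by
    have hu : Measurable (Function.uncurry fun (b : ↥(Bor)) (k : ↥(Kc)) => Φ ((b : GL (Fin n) 𝔸) * (k : GL (Fin n) 𝔸))) :=
      hΦm.comp ((continuous_subtype_val.comp continuous_fst).mul (continuous_subtype_val.comp continuous_snd)).measurable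
    exact hu.lintegral_prod_right'
  rw [step2 _ hGm]
  have hswap : ∀ t : ↥(Tor),
      ∫⁻ v, ∫⁻ k, Φ ((((t : ↥(Bor)) * ((E.symm v : ↥(Uni)) : ↥(Bor)) : ↥(Bor)) : GL (Fin n) 𝔸) * (k : GL (Fin n) 𝔸)) ∂μK ∂μN =
        (∫⁻ k, F ((((t : ↥(Bor)) : GL (Fin n) 𝔸)) * (k : GL (Fin n) 𝔸)) *
          ((colRangeDiagModulus (n := n) (K := K) 1 (n - 1) (borelDiagUnit (t : ↥(Bor))) : ℝ≥0∞))⁻¹ ∂μK) * V := by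
    intro t
    have hu : Measurable (Function.uncurry fun (v : ↥(adelicColRange n K 1 (n - 1))) (k : ↥(Kc)) =>
        Φ ((((t : ↥(Bor)) : GL (Fin n) 𝔸)) * (v : GL (Fin n) 𝔸) * (k : GL (Fin n) 𝔸))) :=
      hΦm.comp (((continuous_const.mul (continuous_subtype_val.comp continuous_fst)).mul
        (continuous_subtype_val.comp continuous_snd))).measurable
    have e1 : ∀ v k, Φ ((((t : ↥(Bor)) * ((E.symm v : ↥(Uni)) : ↥(Bor)) : ↥(Bor)) : GL (Fin n) 𝔸) * (k : GL (Fin n) 𝔸)) =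
        Φ ((((t : ↥(Bor)) : GL (Fin n) 𝔸)) * (v : GL (Fin n) 𝔸) * (k : GL (Fin n) 𝔸)) := by
      intro v k; rfl
    simp_rw [e1]
    rw [lintegral_lintegral_swap hu.aemeasurable]
    have e2 : ∀ k : ↥(Kc),
        ∫⁻ v, Φ ((((t : ↥(Bor)) : GL (Fin n) 𝔸)) * (v : GL (Fin n) 𝔸) * (k : GL (Fin n) 𝔸)) ∂μN =
        F ((((t : ↥(Bor)) : GL (Fin n) 𝔸)) * (k : GL (Fin n) 𝔸)) *
          (((colRangeDiagModulus (n := n) (K := K) 1 (n - 1) (borelDiagUnit (t : ↥(Bor))) : ℝ≥0∞))⁻¹ * V) :=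
      fun k => step3 t k
    simp_rw [e2, ← mul_assoc]
    rw [lintegral_mul_const]
    exact ((hF.comp (continuous_const.mul continuous_subtype_val).measurable).mul measurable_const)
  simp_rw [hswap]
  rw [lintegral_mul_const' _ _ hVtop, mul_comm _ V, ← mul_assoc, mul_comm (c : ℝ≥0∞) V, mul_assoc]

end Iwasawa

end Literature.NumberTheory.Automorphic
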